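import Summits.HubbardSuperconductivity.HubbardSuperconductivity.Theorems.AnisotropyChordStiffnessHelicity

/-!
# Route `AnisotropyChord` / H0 rotor rung: inside the locality stub `KLipschitzDeficit` — the large-`k` branch,
# the filtered kernel over bond pairs (theory seat memo ROTOR-THEORY-8 §120; Sketch8 Part P ported)

PROVED (theory seat, ported verbatim up to names): `filtered_le_firstMoment` (Σg_Ω X ≤ Ω⁻² m₁ via
`sectorVanishing`), `abs_lorentzFilter_le`, `filteredKernel_norm_le` (|Σᵢ g_Ω conj⟨vᵢ,x⟩⟨vᵢ,y⟩| ≤ ‖x‖‖y‖/2Ω) and its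
lattice form, `filteredForm_eq_kernel_sum`; spectral first moment `sum_excitation_mul_norm_sq`, the double-commutator
identity `doubleComm_expect_eq`, `firstMoment_le_doubleComm`, `minEnergyOn_mul_le_rayleigh`,
**`firstMomentLocality_of_doubleComm : DoubleCommutatorBound → FirstMomentLocality`**, `filteredKernel_conj_symm`,
`norm_filteredKernel_eq_half_of_symm`.  TYPED stubs: K1 `FirstMomentLocality`, K1′ `DoubleCommutatorBound` (support
counting), K2 `FarFieldKernelDecay` (Lieb–Robinson), K3 `FilteredKernelSymmetric` (time reversal).
Typing authority: theory seat `hubbard-h0-rotor-theory-1`, cycle 8 (work-order §121: W5 = K1′, W6 = K3, W7 = K2).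
-/

set_option linter.dupNamespace false

noncomputable section

open Matrix Complex Finset Filter Topology MeasureTheory
open scoped ComplexConjugate
open Literature.MathematicalPhysics.QuantumLattice hiding torusPhase torusNorm
open Literature.Probability.LatticeModels
open Summit.HubbardSuperconductivity.HubbardSuperconductivity.Theorems.AnisotropyChord.InsertionEntropy

namespace Summit.HubbardSuperconductivity.HubbardSuperconductivity.Theorems.AnisotropyChord.Stiffness

/-! ## Part P — the large-`k` branch and the filtered kernel -/

/-- **LARGE-k BRANCH (PROVED).** `Σᵢ g_Ω(ωᵢ)|Σⱼεⱼ⟨vᵢ,Jʲ_kψ⟩|² ≤ Ω⁻² Σᵢ ωᵢ|Σⱼεⱼ⟨vᵢ,Jʲ_kψ⟩|²`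
(`g_Ω(ω) ≤ ω/Ω²` for `ω ≥ 0`; no weight below the sector ground energy by `sectorVanishing`). -/
theorem filtered_le_firstMoment (L : ℕ) [NeZero L] (Δ M : ℝ) (a : (TorusSite 2 L → Fin 2) → ℝ)
    (ha : IsPerronSectorGroundAmplitude L Δ M a) (k : TorusSite 2 L) (ε : Fin 2 → ℂ)
    (Ω : ℝ) (hΩ : 0 < Ω) :
    ∑ i, lorentzFilter Ω (excitation L Δ M i) * ‖∑ j, ε j * currentAmp L Δ a k j i‖ ^ 2
      ≤ 1 / Ω ^ 2 * ∑ i, excitation L Δ M i * ‖∑ j, ε j * currentAmp L Δ a k j i‖ ^ 2 := by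
  have hmem : (∑ j, ε j • (currentMode L k j *ᵥ toC L a)) ∈
      spinZSector (Λ := TorusSite 2 L) 1 M :=
    Submodule.sum_mem _ fun j _ =>
      Submodule.smul_mem _ _ (currentMode_mulVec_mem_spinZSector L k j M ha.sector)
  rw [Finset.mul_sum]
  refine Finset.sum_le_sum fun i _ => ?_
  rcases lt_or_ge (excitation L Δ M i) 0 with hlt | hge
  · have h0 : ∑ j, ε j * currentAmp L Δ a k j i = 0 := by
      rw [sum_currentAmp_eq, sectorVanishing L Δ M hmem i hlt]
    rw [h0, norm_zero]
    simp
  · rw [← mul_assoc]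
    refine mul_le_mul_of_nonneg_right ?_ (sq_nonneg _)
    unfold lorentzFilter
    rw [one_div_mul_eq_div]
    exact div_le_div_of_nonneg_left hge (by positivity)
      (by nlinarith [sq_nonneg (excitation L Δ M i)])

/-- `|g_Ω(ω)| ≤ 1/(2Ω)`. -/
theorem abs_lorentzFilter_le {Ω : ℝ} (hΩ : 0 < Ω) (ω : ℝ) : |lorentzFilter Ω ω| ≤ 1 / (2 * Ω) := by
  unfold lorentzFilter
  rw [abs_div, abs_of_pos (by positivity : (0:ℝ) < ω ^ 2 + Ω ^ 2),
    div_le_div_iff₀ (by positivity) (by positivity)]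
  nlinarith [sq_nonneg (|ω| - Ω), sq_abs ω]

/-- **FILTERED KERNEL SUP BOUND (PROVED; abstract).** For a Hermitian `H`, any `E`, `Ω > 0` and vectors
`x, y`: `|Σᵢ g_Ω(λᵢ − E) conj⟨vᵢ,x⟩⟨vᵢ,y⟩| ≤ ‖x‖‖y‖/(2Ω)` (Cauchy–Schwarz + Parseval over the eigenbasis).
Applied to `x = j_bψ`, `y = j_{b'}ψ` it is the crude near-field bound on the filtered current kernel. -/
theorem filteredKernel_norm_le {m : Type*} [Fintype m] [DecidableEq m] {H : Matrix m m ℂ}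
    (hH : H.IsHermitian) (E Ω : ℝ) (hΩ : 0 < Ω) (x y : m → ℂ) :
    ‖∑ i, (lorentzFilter Ω (hH.eigenvalues i - E) : ℂ) *
        (starRingEnd ℂ (star (⇑(hH.eigenvectorBasis i)) ⬝ᵥ x) *
          (star (⇑(hH.eigenvectorBasis i)) ⬝ᵥ y))‖
      ≤ 1 / (2 * Ω) * (‖WithLp.toLp 2 x‖ * ‖WithLp.toLp 2 y‖) := by
  have h1 : ‖∑ i, (lorentzFilter Ω (hH.eigenvalues i - E) : ℂ) *
        (starRingEnd ℂ (star (⇑(hH.eigenvectorBasis i)) ⬝ᵥ x) *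
          (star (⇑(hH.eigenvectorBasis i)) ⬝ᵥ y))‖
      ≤ ∑ i, 1 / (2 * Ω) * (‖star (⇑(hH.eigenvectorBasis i)) ⬝ᵥ x‖ *
          ‖star (⇑(hH.eigenvectorBasis i)) ⬝ᵥ y‖) := by
    refine (norm_sum_le _ _).trans (Finset.sum_le_sum fun i _ => ?_)
    rw [norm_mul, norm_mul, Complex.norm_real, Complex.norm_conj, Real.norm_eq_abs]
    exact mul_le_mul_of_nonneg_right (abs_lorentzFilter_le hΩ _)
      (mul_nonneg (norm_nonneg _) (norm_nonneg _))
  have h2 : ∑ i, ‖star (⇑(hH.eigenvectorBasis i)) ⬝ᵥ x‖ * ‖star (⇑(hH.eigenvectorBasis i)) ⬝ᵥ y‖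
      ≤ ‖WithLp.toLp 2 x‖ * ‖WithLp.toLp 2 y‖ := by
    have hcs := Finset.sum_mul_sq_le_sq_mul_sq Finset.univ
      (fun i => ‖star (⇑(hH.eigenvectorBasis i)) ⬝ᵥ x‖)
      (fun i => ‖star (⇑(hH.eigenvectorBasis i)) ⬝ᵥ y‖)
    rw [sum_norm_sq_dotProduct_eigenvectorBasis hH x, sum_norm_sq_dotProduct_eigenvectorBasis hH y,
      ← mul_pow] at hcs
    exact le_of_pow_le_pow_left₀ two_ne_zero (by positivity) hcs
  calc _ ≤ _ := h1
    _ = 1 / (2 * Ω) * ∑ i, ‖star (⇑(hH.eigenvectorBasis i)) ⬝ᵥ x‖ *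
          ‖star (⇑(hH.eigenvectorBasis i)) ⬝ᵥ y‖ := by rw [Finset.mul_sum]
    _ ≤ _ := mul_le_mul_of_nonneg_left h2 (by positivity)

/-- Amplitude of a single bond current in the eigenbasis: `⟨vᵢ, j_{x,x+e_j} ψ⟩`. -/
def bondAmp (L : ℕ) [NeZero L] (Δ : ℝ) (a : (TorusSite 2 L → Fin 2) → ℝ) (x : TorusSite 2 L)
    (j : Fin 2) (i : TorusSite 2 L → Fin 2) : ℂ :=
  star (⇑((hcbHamiltonian_isHermitian L Δ).eigenvectorBasis i)) ⬝ᵥ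
    (bondCurrent L x (x + Pi.single j 1) *ᵥ toC L a)

/-- The filtered current kernel over bond pairs: `F^Ω_{(x,j),(y,j')} = Σᵢ g_Ω(ωᵢ) conj⟨vᵢ,jʲ_xψ⟩⟨vᵢ,j^{j'}_yψ⟩`. -/
def filteredKernel (L : ℕ) [NeZero L] (Δ M : ℝ) (a : (TorusSite 2 L → Fin 2) → ℝ) (Ω : ℝ)
    (x : TorusSite 2 L) (j : Fin 2) (y : TorusSite 2 L) (j' : Fin 2) : ℂ :=
  ∑ i, (lorentzFilter Ω (excitation L Δ M i) : ℂ) *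
    (starRingEnd ℂ (bondAmp L Δ a x j i) * bondAmp L Δ a y j' i)

/-- The crude near-field bound on the filtered current kernel (PROVED, from `filteredKernel_norm_le`). -/
theorem filteredKernel_lattice_norm_le (L : ℕ) [NeZero L] (Δ M : ℝ) (a : (TorusSite 2 L → Fin 2) → ℝ)
    (Ω : ℝ) (hΩ : 0 < Ω) (x : TorusSite 2 L) (j : Fin 2) (y : TorusSite 2 L) (j' : Fin 2) :
    ‖filteredKernel L Δ M a Ω x j y j'‖ ≤ 1 / (2 * Ω) *
      (‖WithLp.toLp 2 (bondCurrent L x (x + Pi.single j 1) *ᵥ toC L a)‖ *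
        ‖WithLp.toLp 2 (bondCurrent L y (y + Pi.single j' 1) *ᵥ toC L a)‖) := by
  unfold filteredKernel bondAmp excitation lowestEnergyInSector
  exact filteredKernel_norm_le (hcbHamiltonian_isHermitian L Δ) _ Ω hΩ _ _

/-- **STUB K1 — FIRST-MOMENT LOCALITY (pure locality; memo §120).** `m₁(k;ε) := Σᵢ ωᵢ|Σⱼεⱼ⟨vᵢ,Jʲ_kψ⟩|² ≤ C_J L² |ε|²`.
Memo proof: `m₁(Wψ) = ⟨Wψ,(H−E)Wψ⟩ ≤ ⟨ψ,[W†,[H,W]]ψ⟩ ≤ ‖[W†,[H,W]]‖` (the dropped term `⟨W†ψ,(H−E)W†ψ⟩` is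
`≥ 0` because `W†ψ ∈ sector`), and `[W†,[H,W]] = Σ_{b,b'} c̄_{b'}c_b [j_{b'}†,[H,j_b]]` has only `O(L²)` non-zero
bond pairs (`b'` within distance 2 of `b`), each of norm `O(1)`. Size M (operator-norm bookkeeping over
`onSite` products). -/
def FirstMomentLocality (Δ : ℝ) (M : ℕ → ℝ) : Prop :=
  ∃ CJ : ℝ, 0 < CJ ∧ ∀ᶠ L : ℕ in atTop, ∀ [NeZero L],
    ∀ a : (TorusSite 2 L → Fin 2) → ℝ, IsPerronSectorGroundAmplitude L Δ (M L - 1) a →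
    ∀ (k : TorusSite 2 L) (ε : Fin 2 → ℂ),
      ∑ i, excitation L Δ (M L - 1) i * ‖∑ j, ε j * currentAmp L Δ a k j i‖ ^ 2
        ≤ CJ * (L : ℝ) ^ 2 * ∑ j, ‖ε j‖ ^ 2

/-- **STUB K2 — FAR-FIELD DECAY OF THE FILTERED KERNEL (Lieb–Robinson; memo §116/§120).**
`|F^Ω_{bb'} + F^Ω_{b'b}| ≤ (c/Ω)·(e^{−Ω·dist(b,b')/(2v)} + C_LR e^{−μ·dist(b,b')/2})` for all `Ω > 0`:
the symmetrised kernel is `(i/2)∫ w_Ω(t)⟨ψ,[τ_t(j_b)†, j_{b'}]ψ⟩dt` (`filteredSpectral_identity_odd`,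
`‖w_Ω‖₁ = 1/Ω`), the commutator is bounded by the torus Lieb–Robinson bound for `|t| ≤ T = dist/(2v)` and by
`2‖j‖²` for `|t| > T` (`∫_{|t|>T}|w_Ω| = e^{−ΩT}/Ω`). Size M/L. -/
def FarFieldKernelDecay (Δ : ℝ) (M : ℕ → ℝ) : Prop :=
  ∃ c : ℝ, 0 < c ∧ ∃ v : ℝ, 0 < v ∧ ∃ μ : ℝ, 0 < μ ∧ ∃ CLR : ℝ, 0 < CLR ∧
    ∀ᶠ L : ℕ in atTop, ∀ [NeZero L],
    ∀ a : (TorusSite 2 L → Fin 2) → ℝ, IsPerronSectorGroundAmplitude L Δ (M L - 1) a →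
    ∀ Ω : ℝ, 0 < Ω → ∀ (x y : TorusSite 2 L) (j j' : Fin 2),
      ‖filteredKernel L Δ (M L - 1) a Ω x j y j' + filteredKernel L Δ (M L - 1) a Ω y j' x j‖
        ≤ c / Ω * (Real.exp (-(Ω * (torusDist (Ls := fun _ : Fin 2 => L) x y : ℝ) / (2 * v)))
          + CLR * Real.exp (-(μ * (torusDist (Ls := fun _ : Fin 2 => L) x y : ℝ) / 2)))

/-- The filtered current form is the bond-pair double sum of the kernel against the phases (PROVED):
`Σᵢ g_Ω(ωᵢ)|Σⱼ εⱼ⟨vᵢ,Jʲ_kψ⟩|² = Σ_{(x,j),(y,j')} conj(εⱼ e^{ik·x}) (ε_{j'} e^{ik·y}) F^Ω_{(x,j),(y,j')}`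
(sum over ordered bond pairs; the near/far split of memo §120 is a split of this sum by `dist(x,y) ≤ R`). -/
theorem filteredForm_eq_kernel_sum (L : ℕ) [NeZero L] (Δ M : ℝ) (a : (TorusSite 2 L → Fin 2) → ℝ)
    (Ω : ℝ) (k : TorusSite 2 L) (ε : Fin 2 → ℂ) :
    ((∑ i, lorentzFilter Ω (excitation L Δ M i) * ‖∑ j, ε j * currentAmp L Δ a k j i‖ ^ 2 : ℝ) : ℂ)
      = ∑ p : (TorusSite 2 L × Fin 2) × (TorusSite 2 L × Fin 2),
          starRingEnd ℂ (ε p.1.2 * torusPhase L k p.1.1) * (ε p.2.2 * torusPhase L k p.2.1) *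
            filteredKernel L Δ M a Ω p.1.1 p.1.2 p.2.1 p.2.2 := by
  -- expand `currentAmp` over bonds
  have hamp : ∀ i j, currentAmp L Δ a k j i = ∑ x, torusPhase L k x * bondAmp L Δ a x j i := by
    intro i j
    unfold currentAmp currentMode bondAmp
    rw [sum_smul_mulVec, dotProduct_sum]
    refine Finset.sum_congr rfl fun x _ => ?_
    rw [dotProduct_smul, smul_eq_mul]
  have hA : ∀ i, ∑ j, ε j * currentAmp L Δ a k j i
      = ∑ q : TorusSite 2 L × Fin 2, ε q.2 * torusPhase L k q.1 * bondAmp L Δ a q.1 q.2 i := by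
    intro i
    rw [Fintype.sum_prod_type, Finset.sum_comm]
    refine Finset.sum_congr rfl fun j _ => ?_
    rw [hamp, Finset.mul_sum]
    refine Finset.sum_congr rfl fun x _ => ?_
    dsimp only
    ring
  have hL : ((∑ i, lorentzFilter Ω (excitation L Δ M i) * ‖∑ j, ε j * currentAmp L Δ a k j i‖ ^ 2 : ℝ) : ℂ)
      = ∑ i, (lorentzFilter Ω (excitation L Δ M i) : ℂ) *
          (starRingEnd ℂ (∑ j, ε j * currentAmp L Δ a k j i) * (∑ j, ε j * currentAmp L Δ a k j i)) := by
    push_cast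
    refine Finset.sum_congr rfl fun i _ => ?_
    rw [Complex.conj_mul']
  rw [hL]
  simp_rw [hA]
  symm
  calc ∑ p : (TorusSite 2 L × Fin 2) × (TorusSite 2 L × Fin 2),
          starRingEnd ℂ (ε p.1.2 * torusPhase L k p.1.1) * (ε p.2.2 * torusPhase L k p.2.1) *
            filteredKernel L Δ M a Ω p.1.1 p.1.2 p.2.1 p.2.2
      = ∑ p : (TorusSite 2 L × Fin 2) × (TorusSite 2 L × Fin 2), ∑ i,
          (lorentzFilter Ω (excitation L Δ M i) : ℂ) *
            (starRingEnd ℂ (ε p.1.2 * torusPhase L k p.1.1 * bondAmp L Δ a p.1.1 p.1.2 i) *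
              (ε p.2.2 * torusPhase L k p.2.1 * bondAmp L Δ a p.2.1 p.2.2 i)) := by
        refine Finset.sum_congr rfl fun p _ => ?_
        unfold filteredKernel
        rw [Finset.mul_sum]
        refine Finset.sum_congr rfl fun i _ => ?_
        simp only [map_mul]
        ring
    _ = ∑ i, ∑ p : (TorusSite 2 L × Fin 2) × (TorusSite 2 L × Fin 2),
          (lorentzFilter Ω (excitation L Δ M i) : ℂ) *
            (starRingEnd ℂ (ε p.1.2 * torusPhase L k p.1.1 * bondAmp L Δ a p.1.1 p.1.2 i) *
              (ε p.2.2 * torusPhase L k p.2.1 * bondAmp L Δ a p.2.1 p.2.2 i)) := Finset.sum_comm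
    _ = _ := by
        refine Finset.sum_congr rfl fun i _ => ?_
        rw [map_sum, Finset.sum_mul_sum, Fintype.sum_prod_type, Finset.mul_sum]
        simp only [Finset.mul_sum]


end Summit.HubbardSuperconductivity.HubbardSuperconductivity.Theorems.AnisotropyChord.Stiffness
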